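import Literature.Computability.AlgebraicComplexity.StrassenMinimalBorderRank
import Literature.Computability.AlgebraicComplexity.KoszulFlatteningKronecker
import Literature.Computability.AlgebraicComplexity.BorderRankRestriction
import Literature.Computability.AlgebraicComplexity.BorderRankCW
import Literature.Computability.AlgebraicComplexity.QuantumFunctionalsDirectSumMarginals
import HarnessLib

/-!
# The unit-catalyst door for `T_cw,2` is closed at every level: `R̲(T_cw,2^{⊠N} ⊕ ⟨m⟩) > 3^N + m`

`SoloInformedCatalystDoor.lean` proved the door
`(∃ N ≥ 1, ∃ m, R̲(T_cw,2^{⊠N} ⊕ ⟨m⟩) ≤ m + 3^N) → MatrixMultiplication` and closed its level `N = 1`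
(`R̲(T_cw,2^{⊕n} ⊕ ⟨m⟩) = 4n + m`).  Here we close EVERY level: for all `N ≥ 1` and all `m`,

  `3^N + m < R̲(T_cw,2^{⊠N} ⊕ ⟨m⟩)`     (`lt_algBorderRank_kroneckerPow_cwTensor_two_directSum_unit`),

over any field, so the hypothesis of `matrixMultiplication_of_cwTensor_two_catalyst` is false
(`not_exists_cwTensor_two_unit_catalyst`): a unit catalyst can never carry a finite Kronecker power
of `T_cw,2` to the flattening value `3^N`.  (The sub-summit rungs of that file, e.g.
`R̲(perm₃ ⊕ ⟨m⟩) ≤ 15 + m ⇒ R̃(T_cw,2) ≤ √15`, are not affected: `15 + m > 9 + m`.)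

## Proof (Strassen's equations for minimal border rank, `StrassenMinimalBorderRank.lean`)

`T = T_cw,2^{⊠N} ⊕ ⟨m⟩` is concise of format `M = 3^N + m` in each factor, so `R̲(T) ≤ 3^N + m`
would make `T` a tensor of minimal border rank.  Twist the second factor by
`G = (S⁻¹)^{⊗N} ⊕ 1`, where `S = T_cw,2(a₀^* + a₁^*)` is an invertible slice; the twisted tensor
`T'` is a restriction of `T` (`R̲(T') ≤ R̲(T) ≤ M`) and its first-factor slice at the covector
`ξ₀ = (a₀^*+a₁^*)^{⊗N} ⊕ (1,…,1)` is the identity.  By Strassen's equations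
(`slice_mul_adjugate_mul_comm_of_isApproxDecomposition`) all slices of `T'` then commute.  But the
slices at `ξ₁ = a₀^* ⊗ (a₀^*+a₁^*)^{⊗(N-1)} ⊕ 0` and `ξ₂ = a₂^* ⊗ (a₀^*+a₁^*)^{⊗(N-1)} ⊕ 0` are
`(S⁻¹B) ⊗ 1 ⊕ 0` and `(S⁻¹C) ⊗ 1 ⊕ 0` with `B = T_cw,2(a₀^*)`, `C = T_cw,2(a₂^*)`, and
`(S⁻¹B)(S⁻¹C) ≠ (S⁻¹C)(S⁻¹B)` (entry `(1,2)`: `0` versus `1`).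

(On paper the same slices give more, via the `p = 1` Koszul flattening
`rank = 2M + rank [S⁻¹B ⊗ 1, S⁻¹C ⊗ 1] = 2M + 2·3^{N-1}` and Landsberg–Ottaviani:
`R̲(T_cw,2^{⊠N} ⊕ ⟨m⟩) ≥ 3^N + 3^{N-1} + m`; only the strict inequality is formalised here, which is
what closes the door.)

## References

* J. M. Landsberg, *Geometry and Complexity Theory*, CUP 2017, Prop. 2.2.1.3, Thm. 2.2.2.1, §2.4.1
  (Strassen's equations; formalised in `StrassenMinimalBorderRank.lean`). [Landsberg2017]
* J. Buczyński, E. Postinghel, F. Rupniewski, *On Strassen's rank additivity for small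
  three-way tensors*, SIAM J. Matrix Anal. Appl. 41 (2020), arXiv:1902.06582, p. 4 (Problem 2:
  is `R̲(T ⊕ ⟨1⟩) > R̲(T)`?  Here only the weaker `R̲(T_cw,2^{⊠N} ⊕ ⟨m⟩) > 3^N + m` is needed and
  proved). [BuczynskiPostinghelRupniewski2020]
-/

noncomputable section

open scoped BigOperators Polynomial Matrix
open Matrix Polynomial

namespace Summit.MatrixMultiplication.MatrixMultiplication.Theorems

open Literature.Computability.AlgebraicComplexity

universe u

/-! ## Product covectors and coordinatewise-product matrices -/

/-! Helpers live in their own namespace (generic names such as `piMatrix` occur elsewhere). -/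
namespace CatalystNoGo

section PiMatrix

variable {K : Type u} [CommRing K] {ι κ μ : Type*}

/-- The product covector `Γ₀ ⊗ Γ₁ ⊗ ⋯ ⊗ Γ_{N-1}` on `A^{⊗N}`: `a ↦ ∏ᵢ Γᵢ(aᵢ)`. [folklore] -/
def prodCovector {N : ℕ} (Γ : Fin N → ι → K) : (Fin N → ι) → K := fun a => ∏ i, Γ i (a i)

/-- The Kronecker product `F₀ ⊗ ⋯ ⊗ F_{N-1}` of a family of matrices, on index functions:
entry `∏ᵢ Fᵢ(bᵢ, cᵢ)`. [folklore] -/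
def piMatrix {N : ℕ} (F : Fin N → Matrix κ μ K) : Matrix (Fin N → κ) (Fin N → μ) K :=
  Matrix.of fun b c => ∏ i, F i (b i) (c i)

/-- Entries of `piMatrix`. [folklore] -/
theorem piMatrix_apply {N : ℕ} (F : Fin N → Matrix κ μ K) (b : Fin N → κ) (c : Fin N → μ) :
    piMatrix F b c = ∏ i, F i (b i) (c i) := rfl

/-- `B^{⊗N}` is the `piMatrix` of the constant family. [folklore] -/
theorem powMatrix_eq_piMatrix (B : Matrix κ μ K) (N : ℕ) : powMatrix B N = piMatrix fun _ : Fin N => B := rfl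

/-- Slices of a Kronecker power at a product covector are Kronecker products of slices:
`t^{⊠N}(Γ₀ ⊗ ⋯ ⊗ Γ_{N-1}) = t(Γ₀) ⊗ ⋯ ⊗ t(Γ_{N-1})`. [folklore] -/
theorem contractFirst_prodCovector_kroneckerPow [Fintype ι] [DecidableEq ι] {N : ℕ}
    (Γ : Fin N → ι → K) (t : ι → κ → μ → K) :
    contractFirst (prodCovector Γ) (kroneckerPow t N) = piMatrix fun i => contractFirst (Γ i) t := by
  ext b c
  simp only [contractFirst_apply, prodCovector, kroneckerPow_apply, piMatrix_apply,
    ← Finset.prod_mul_distrib]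
  rw [Finset.prod_univ_sum (fun _ => Finset.univ) (fun l i => Γ l i * t i (b l) (c l)),
    Fintype.piFinset_univ]

/-- `(⊗ᵢ Fᵢ)(⊗ᵢ F'ᵢ) = ⊗ᵢ (Fᵢ F'ᵢ)`. [folklore] -/
theorem piMatrix_mul [Fintype μ] [DecidableEq μ] {ν : Type*} {N : ℕ} (F : Fin N → Matrix κ μ K)
    (F' : Fin N → Matrix μ ν K) : piMatrix F * piMatrix F' = piMatrix fun i => F i * F' i := by
  ext b c
  simp only [Matrix.mul_apply, piMatrix_apply, ← Finset.prod_mul_distrib]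
  rw [Finset.prod_univ_sum (fun _ => Finset.univ) (fun l j => F l (b l) j * F' l j (c l)),
    Fintype.piFinset_univ]

/-- `⊗ᵢ 1 = 1`. [folklore] -/
theorem piMatrix_one [DecidableEq κ] (N : ℕ) : (piMatrix fun _ : Fin N => (1 : Matrix κ κ K)) = 1 := by
  rw [← powMatrix_eq_piMatrix, powMatrix_one]

end PiMatrix

/-! ## Slices of direct sums and of the unit tensor -/

section Slices

variable {K : Type u} [CommRing K] {ι κ μ ι' κ' μ' : Type*}

/-- The first-factor slices of a direct sum are block diagonal (mixed entries vanish: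
`directSumTensor_inl_inl_inr`, `directSumTensor_inr_inr_inl` of
`QuantumFunctionalsDirectSumMarginals.lean`). [folklore] -/
theorem contractFirst_sumElim_directSumTensor [Fintype ι] [Fintype ι'] (ξ : ι → K) (η : ι' → K)
    (s : ι → κ → μ → K) (t : ι' → κ' → μ' → K) :
    contractFirst (Sum.elim ξ η) (directSumTensor s t) =
      Matrix.fromBlocks (contractFirst ξ s) 0 0 (contractFirst η t) := by
  ext b c
  rcases b with b | b <;> rcases c with c | c <;>
    simp [contractFirst_apply, Fintype.sum_sum_type, Matrix.fromBlocks, directSumTensor_inl_inl_inr,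
      directSumTensor_inr_inr_inl]

/-- The slice of `⟨m⟩` at the all-ones covector is the identity matrix. [folklore] -/
theorem contractFirst_one_unitTensor (m : ℕ) :
    contractFirst (fun _ => (1 : K)) (unitTensor K m) = 1 := by
  ext j k
  simp only [contractFirst_apply, unitTensor_apply, one_mul, Matrix.one_apply]
  by_cases hjk : j = k
  · subst hjk
    rw [Finset.sum_eq_single j (fun i _ hi => by simp [hi]) (by simp)]
    simp
  · rw [if_neg hjk]
    exact Finset.sum_eq_zero fun i _ => by
      rw [if_neg]
      rintro ⟨rfl, h⟩
      exact hjk h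

/-- The slice at the zero covector vanishes. [folklore] -/
theorem contractFirst_zero [Fintype ι] (t : ι → κ → μ → K) :
    contractFirst (fun _ => (0 : K)) t = 0 := by
  ext b c
  simp [contractFirst_apply]

end Slices

/-! ## The three `3 × 3` slices of `T_cw,2` and the non-commutation witness -/

section CwTwo

variable (K : Type u) [Field K]

/-- `a₀^* + a₁^*`. -/
def cwα : Fin 3 → K := ![1, 1, 0]
/-- `a₀^*`. -/
def cwβ : Fin 3 → K := ![1, 0, 0]
/-- `a₂^*`. -/
def cwγ : Fin 3 → K := ![0, 0, 1]

/-- `S = T_cw,2(a₀^* + a₁^*) = b₀c₁ + b₁c₀ + b₁c₁ + b₂c₂`. [folklore] -/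
theorem contractFirst_cwα : contractFirst (cwα K) (cwTensor K 2) = !![0, 1, 0; 1, 1, 0; 0, 0, 1] := by
  ext i j
  fin_cases i <;> fin_cases j <;>
    simp [contractFirst_apply, Fin.sum_univ_three, cwTensor_apply, cwα]

/-- `B = T_cw,2(a₀^*) = b₁c₁ + b₂c₂`. [folklore] -/
theorem contractFirst_cwβ : contractFirst (cwβ K) (cwTensor K 2) = !![0, 0, 0; 0, 1, 0; 0, 0, 1] := by
  ext i j
  fin_cases i <;> fin_cases j <;>
    simp [contractFirst_apply, Fin.sum_univ_three, cwTensor_apply, cwβ]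

/-- `C = T_cw,2(a₂^*) = b₀c₂ + b₂c₀`. [folklore] -/
theorem contractFirst_cwγ : contractFirst (cwγ K) (cwTensor K 2) = !![0, 0, 1; 0, 0, 0; 1, 0, 0] := by
  ext i j
  fin_cases i <;> fin_cases j <;>
    simp [contractFirst_apply, Fin.sum_univ_three, cwTensor_apply, cwγ]

/-- `S⁻¹`. -/
def cwSinv : Matrix (Fin 3) (Fin 3) K := !![-1, 1, 0; 1, 0, 0; 0, 0, 1]

/-- `S⁻¹ S = 1`. [folklore] -/
theorem cwSinv_mul_S : cwSinv K * contractFirst (cwα K) (cwTensor K 2) = 1 := by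
  rw [contractFirst_cwα, cwSinv]
  ext i j
  fin_cases i <;> fin_cases j <;> simp

/-- The witness: `((S⁻¹B)(S⁻¹C))₁₂ = 0`. -/
theorem cw_XY_entry :
    (cwSinv K * contractFirst (cwβ K) (cwTensor K 2) * (cwSinv K * contractFirst (cwγ K) (cwTensor K 2)))
      1 2 = 0 := by
  rw [contractFirst_cwβ, contractFirst_cwγ, cwSinv]
  simp

/-- The witness: `((S⁻¹C)(S⁻¹B))₁₂ = 1`. -/
theorem cw_YX_entry :
    (cwSinv K * contractFirst (cwγ K) (cwTensor K 2) * (cwSinv K * contractFirst (cwβ K) (cwTensor K 2)))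
      1 2 = 1 := by
  rw [contractFirst_cwβ, contractFirst_cwγ, cwSinv]
  simp

end CwTwo

end CatalystNoGo

/-! ## The theorem -/

section Main

open CatalystNoGo

variable (K : Type u) [Field K]

/-- **`3^N + m < R̲(T_cw,2^{⊠N} ⊕ ⟨m⟩)` for every `N ≥ 1` and every `m`, over any field**: a direct sum of
a Kronecker power of the little Coppersmith–Winograd tensor `T_cw,2` and a unit tensor is never of
minimal border rank (Strassen's equations; see the module docstring).
[cite: Landsberg2017, Prop. 2.2.1.3, Thm. 2.2.2.1] -/
theorem lt_algBorderRank_kroneckerPow_cwTensor_two_directSum_unit (N m : ℕ) :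
    3 ^ (N + 1) + m <
      algBorderRank (directSumTensor (kroneckerPow (cwTensor K 2) (N + 1)) (unitTensor K m)) := by
  classical
  by_contra hle
  rw [not_lt] at hle
  -- notation
  set T := directSumTensor (kroneckerPow (cwTensor K 2) (N + 1)) (unitTensor K m) with hT
  set M : ℕ := Fintype.card ((Fin (N + 1) → Fin 3) ⊕ Fin m) with hMdef
  have hM : M = 3 ^ (N + 1) + m := by simp [hMdef, Fintype.card_sum]
  set e : Fin M ≃ ((Fin (N + 1) → Fin 3) ⊕ Fin m) := (Fintype.equivFin _).symm with he
  -- the twist `G = (S⁻¹)^{⊗(N+1)} ⊕ 1` on the second factor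
  set G : Matrix ((Fin (N + 1) → Fin 3) ⊕ Fin m) ((Fin (N + 1) → Fin 3) ⊕ Fin m) K :=
    Matrix.fromBlocks (powMatrix (cwSinv K) (N + 1)) 0 0 1 with hG
  -- an approximate decomposition of `T` with exactly `M` triads
  obtain ⟨h, hh⟩ := exists_algBorderRank_eq_approxRank T
  have hTM : approxRank h T ≤ M := by rw [← hh, hM]; exact hle
  obtain ⟨u, v, w, hd⟩ := exists_isApproxDecomposition_of_approxRank_le hTM
  -- the twisted tensor of all slices, reindexed by `Fin M`
  set L : (((Fin (N + 1) → Fin 3) ⊕ Fin m) → K) → Fin M → Fin M → K :=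
    fun ξ b c => ∑ x, ∑ b', ∑ c', ξ x * G (e b) b' * (if c' = e c then (1 : K) else 0) * T x b' c'
    with hL
  have hdL := hd.restrict (fun (ξ : ((Fin (N + 1) → Fin 3) ⊕ Fin m) → K) x => ξ x)
    (fun (b : Fin M) b' => G (e b) b') (fun (c : Fin M) c' => if c' = e c then (1 : K) else 0)
  -- closed form of the slices of `L`
  have HL : ∀ ξ, Matrix.of (L ξ) = (G * contractFirst ξ T).submatrix e e := by
    intro ξ
    ext b c
    simp only [hL, Matrix.of_apply, Matrix.submatrix_apply, Matrix.mul_apply, contractFirst_apply,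
      mul_ite, mul_one, mul_zero, ite_mul, zero_mul, Finset.sum_ite_eq', Finset.mem_univ, if_true]
    rw [Finset.sum_comm]
    refine Finset.sum_congr rfl fun b' _ => ?_
    rw [Finset.mul_sum]
    refine Finset.sum_congr rfl fun x _ => ?_
    ring
  -- the three covectors
  set ξ₀ : ((Fin (N + 1) → Fin 3) ⊕ Fin m) → K :=
    Sum.elim (prodCovector fun _ : Fin (N + 1) => cwα K) (fun _ => 1) with hξ₀
  set ξ₁ : ((Fin (N + 1) → Fin 3) ⊕ Fin m) → K :=
    Sum.elim (prodCovector (Fin.cons (cwβ K) fun _ : Fin N => cwα K)) (fun _ => 0) with hξ₁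
  set ξ₂ : ((Fin (N + 1) → Fin 3) ⊕ Fin m) → K :=
    Sum.elim (prodCovector (Fin.cons (cwγ K) fun _ : Fin N => cwα K)) (fun _ => 0) with hξ₂
  -- Strassen's equations
  have hS := slice_mul_adjugate_mul_comm_of_isApproxDecomposition hdL ξ₁ ξ₀ ξ₂
  -- the slice at `ξ₀` is the identity
  have hG0 : G * contractFirst ξ₀ T = 1 := by
    rw [hξ₀, hT, contractFirst_sumElim_directSumTensor, contractFirst_one_unitTensor,
      contractFirst_prodCovector_kroneckerPow, hG, Matrix.fromBlocks_multiply]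
    simp only [Matrix.mul_zero, Matrix.zero_mul, add_zero, zero_add, Matrix.one_mul,
      powMatrix_eq_piMatrix, piMatrix_mul, cwSinv_mul_S, piMatrix_one, Matrix.fromBlocks_one]
  have hone : Matrix.of (L ξ₀) = 1 := by
    rw [HL, hG0, Matrix.submatrix_one_equiv]
  rw [hone, adjugate_one, Matrix.mul_one, Matrix.mul_one, HL, HL, Matrix.submatrix_mul_equiv,
    Matrix.submatrix_mul_equiv] at hS
  have hS' : G * contractFirst ξ₁ T * (G * contractFirst ξ₂ T) =
      G * contractFirst ξ₂ T * (G * contractFirst ξ₁ T) := by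
    have := congrArg (fun A : Matrix (Fin M) (Fin M) K => A.submatrix e.symm e.symm) hS
    simpa only [Matrix.submatrix_submatrix, Equiv.self_comp_symm, Matrix.submatrix_id_id] using this
  -- block form of the two slices
  have hG1 : G * contractFirst ξ₁ T = Matrix.fromBlocks
      (piMatrix fun i => cwSinv K *
        contractFirst ((Fin.cons (cwβ K) (fun _ : Fin N => cwα K) : Fin (N + 1) → Fin 3 → K) i)
          (cwTensor K 2))
      0 0 0 := by
    rw [hξ₁, hT, contractFirst_sumElim_directSumTensor, contractFirst_zero,
      contractFirst_prodCovector_kroneckerPow, hG, Matrix.fromBlocks_multiply]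
    simp only [Matrix.mul_zero, Matrix.zero_mul, add_zero, powMatrix_eq_piMatrix, piMatrix_mul]
  have hG2 : G * contractFirst ξ₂ T = Matrix.fromBlocks
      (piMatrix fun i => cwSinv K *
        contractFirst ((Fin.cons (cwγ K) (fun _ : Fin N => cwα K) : Fin (N + 1) → Fin 3 → K) i)
          (cwTensor K 2))
      0 0 0 := by
    rw [hξ₂, hT, contractFirst_sumElim_directSumTensor, contractFirst_zero,
      contractFirst_prodCovector_kroneckerPow, hG, Matrix.fromBlocks_multiply]
    simp only [Matrix.mul_zero, Matrix.zero_mul, add_zero, powMatrix_eq_piMatrix, piMatrix_mul]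
  rw [hG1, hG2, Matrix.fromBlocks_multiply, Matrix.fromBlocks_multiply] at hS'
  simp only [Matrix.mul_zero, Matrix.zero_mul, add_zero, piMatrix_mul] at hS'
  have hP := (Matrix.fromBlocks_inj.1 hS').1
  -- evaluate the entry `((1,0,…,0), (2,0,…,0))`
  have hentry := congr_fun (congr_fun hP (Fin.cons 1 fun _ => 0)) (Fin.cons 2 fun _ => 0)
  simp only [piMatrix_apply, Fin.prod_univ_succ, Fin.cons_zero, Fin.cons_succ, cwSinv_mul_S,
    Matrix.one_apply_eq, Finset.prod_const_one, mul_one] at hentry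
  rw [cw_XY_entry, cw_YX_entry] at hentry
  exact zero_ne_one hentry

/-- **The unit-catalyst door is closed at every level** (refutes the hypothesis of
`matrixMultiplication_of_cwTensor_two_catalyst`): there are no `N ≥ 1`, `m` with
`R̲(T_cw,2^{⊠N} ⊕ ⟨m⟩) ≤ m + 3^N`. [cite: Landsberg2017, Thm. 2.2.2.1] -/
theorem not_exists_cwTensor_two_unit_catalyst :
    ¬ ∃ N : ℕ, N ≠ 0 ∧ ∃ m : ℕ,
      algBorderRank (directSumTensor (kroneckerPow (cwTensor ℂ 2) N) (unitTensor ℂ m)) ≤ m + 3 ^ N := by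
  rintro ⟨N, hN, m, hle⟩
  obtain ⟨N', rfl⟩ := Nat.exists_eq_add_one_of_ne_zero hN
  have := lt_algBorderRank_kroneckerPow_cwTensor_two_directSum_unit ℂ N' m
  omega

/-- In particular (`m = 0` is the plain door, `N ≥ 1`): `3^N < R̲(T_cw,2^{⊠N} ⊕ ⟨m⟩) - m`, uniformly;
at level `N = 2` (`perm₃`): `9 + m < R̲(perm₃ ⊕ ⟨m⟩)`, consistent with (and much weaker than) the open
rung `R̲(perm₃ ⊕ ⟨m⟩) ≤ 15 + m` of `SoloInformedCatalystDoor.lean`. [folklore] -/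
theorem nine_add_lt_algBorderRank_perm3_directSum_unit (m : ℕ) :
    9 + m < algBorderRank (directSumTensor (kroneckerPow (cwTensor ℂ 2) 2) (unitTensor ℂ m)) := by
  simpa using lt_algBorderRank_kroneckerPow_cwTensor_two_directSum_unit ℂ 1 m

end Main

end Summit.MatrixMultiplication.MatrixMultiplication.Theorems

end
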